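import Mathlib
import HarnessLib
import HarnessLib.Audit
import Summits.Langlands.Statement
import Literature.NumberTheory.GaloisRepresentations.LabelledHodgeTateWeights
import Literature.NumberTheory.GaloisRepresentations.ResidualGaloisRep
import Literature.NumberTheory.GaloisRepresentations.AbsGaloisGroup
import Literature.NumberTheory.GaloisRepresentations.PotentialDiagonalizabilityCriteria
import Literature.NumberTheory.GaloisRepresentations.CrystallineDeformationRing
import HarnessLib.Audit.Check
import HarnessLib.Audit.Status.Attr

/-!
Route: NonParallelVoid

DORMANT since 2026-08-25T08:56:21Z (reconciler: no traction for 7.6 d (last activity item-evidence-added at 2026-08-17T19:07:57Z); parked, not closed — `ledger route dormant route-Langlands-NonParallelVoid --off` to reactivate) — unstaffed, not closed; items shared with open routes are served there. `ledger route dormant <id> --off` reactivates.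

# Route NonParallelVoid — non-parallel weights are void over imaginary quadratic fields — twisted
induction polarises, torsion empties R

It suffices to show X = Target (NON-PARALLEL WEIGHTS ARE VOID): for every imaginary quadratic field
F, every prime p and every
irreducible, almost everywhere unramified ρ : Γ_F → GL₂(ℚ̄_p) which is de Rham at each v ∣ p with
two distinct τ-labelled Hodge–Tate
weights {a, b} for every label (v, τ : F_v → ℚ̄_p) (pinned Fontaine datum of the Statement), all
labels have the SAME gap b − a
(∃ g, every HT multiset is {a, a + g}). This is Calegari–Mazur's "parallel weight" prediction
(CalegariMazur2008 Conj. 1.3 and §2.4;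
Calegari2010 Thm 1.4 proves the ordinary, SL₂(𝔽_p)-image, non-base-change case; Childers
arXiv:2001.04956 §1.5 records the rest as open)
and a NECESSARY conjunct of direction (B) of the summit for n = 2 over these fields: a cuspidal π
corresponding to a non-parallel ρ cannot
exist (Clozel's purity lemma / Harder–Borel–Wallach vanishing), so (B) holds there only vacuously. X
is split by residual/local shape into
five cruxes (§ Cruxes); the remainder VoidToLanglands : Target → Langlands is the declared,
not-claimed complement (D-0027 pattern of
EisensteinMonodromy.MonodromyToLanglands, FifteenLocusEisenstein.SectorComplement). No card is
realised (novel-route seat, operator A: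
open-question harvest — Caraiani–Newton/Calegari–Mazur/Childers printed questions).
Lean: `∀ (F : Type) [Field F] [NumberField F] [Algebra.IsQuadraticExtension ℚ F],
NumberField.IsTotallyComplex F → ∀ (p : ℕ) [Fact p.Prime] (ρ :
Literature.NumberTheory.GaloisRepresentations.FramedGaloisRep F (PadicAlgCl p) 2),
ρ.toGaloisRep.IsIrreducible → (∀ᶠ v : IsDedekindDomain.HeightOneSpectrum (NumberField.RingOfIntegers
F) in Filter.cofinite, ρ.IsUnramifiedAt v) → (∀ (v : IsDedekindDomain.HeightOneSpectrum
(NumberField.RingOfIntegers F)) (hv : ((p : ℕ) : NumberField.RingOfIntegers F) ∈ v.asIdeal),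
(Literature.NumberTheory.PAdicHodge.fontainePstAdicCompletion v p hv).IsDeRhamFramed (ρ.toLocal v) ∧
(letI := (Literature.NumberTheory.PAdicHodge.fontainePstAdicCompletion v p hv).algebra; ∀ τ :
v.adicCompletion F →ₐ[ℚ_[p]] PadicAlgCl p, ∃ a b : ℤ, a < b ∧ ρ.labelledHodgeTateWeightsAt v
(Literature.NumberTheory.PAdicHodge.fontainePstAdicCompletion v p hv).algebra
(Literature.NumberTheory.PAdicHodge.fontainePstAdicCompletion v p hv).𝔅 τ.toRingHom = {a, b})) → ∃ g
: ℤ, ∀ (v : IsDedekindDomain.HeightOneSpectrum (NumberField.RingOfIntegers F)) (hv : ((p : ℕ) :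
NumberField.RingOfIntegers F) ∈ v.asIdeal), letI :=
(Literature.NumberTheory.PAdicHodge.fontainePstAdicCompletion v p hv).algebra; ∀ τ :
v.adicCompletion F →ₐ[ℚ_[p]] PadicAlgCl p, ∃ a : ℤ, ρ.labelledHodgeTateWeightsAt v
(Literature.NumberTheory.PAdicHodge.fontainePstAdicCompletion v p hv).algebra
(Literature.NumberTheory.PAdicHodge.fontainePstAdicCompletion v p hv).𝔅 τ.toRingHom = {a, a + g}`

## Assembly
Pure logic (glue.lean, lean check rc 0): `closes : EmptyWeightCore → TwistedInductionParallel →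
TensorSquareParallel →
LocallyReducibleParallel → ResidueParallel → VoidToLanglands → Langlands` applies VoidToLanglands
and proves Target by the exhaustive case
split: by_cases (invariant line at every v ∣ p) → LocallyReducibleParallel; else by_cases (good
regime: 11 ≤ p ∧ p split ∧ crystalline ∧
ρ̄|F(ζ_p) abs. irreducible) — yes: by_cases (even gap difference) → TwistedInductionParallel; odd:
by_cases (base-change type) →
EmptyWeightCore | TensorSquareParallel; no: ResidueParallel. Every crux is a hypothesis of `closes`
and is used. The item Assembly is
the same chain as a Prop (provable by the same case split).

Rationale: WHY THIS LINE. Printed open question: CalegariMazur2008 Conj. 1.3 / Calegari2010 Thm 1.4 leave every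
non-ordinary and every residually base-change-type
non-parallel ρ untouched ("admits infinitesimally classical deformations ⇒ base change, CM or even"
is proved only for Artin ρ under Strong
Leopoldt; Thm 1.4 needs ordinary, p > 7 split, SL₂(𝔽_p) ⊂ im ρ̄ and Proj ρ̄ not extending to Γ_ℚ),
and ACCGHLNSTT2023 Rem. 6.1.3 covers only
ι-ordinary ρ with enormous image. NEW LEVER 1 (twisted induction polarises, crux
TwistedInductionParallel): for an algebraic Hecke character φ of
F of infinity type (a, b), det(ρ⊗φ) is Gal(F/ℚ)-invariant iff 2(b − a) = (gap difference), and
EXACTLY THEN I := Ind_(Γ_F)^(Γ_ℚ)(ρ⊗φ) is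
both Hodge–Tate regular ({a, a+m, b, b+n} distinct) and odd-symplectic (the pairing ⟨x₁,y₁⟩ −
⟨x₂,y₂⟩ has multiplier χ⁻¹η_F, value −1 at
c) — for PARALLEL ρ polarisable forces a = b forces irregular (why elliptic curves over F never
yielded to BLGGT), so non-parallelness is the
resource: BarnetlambEtAl2014 Thm C (l ≥ 2(n+1) = 10, potential diagonalisability — automatic for
2-dimensional crystalline reps of
Γ_{ℚ_p}, p split — and only residual IRREDUCIBILITY over ℚ(ζ_p), arranged by the finite part of φ)
makes I automorphic over a totally real
L; I ≅ I ⊗ η ⇒ Π_L is automorphically induced from a regular algebraic cuspidal π′ on GL₂/FL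
(ArthurClozelAMS120 Ch. 3 Thm 4.2), whose Galois
representation (HarrisLanTaylorThorneRMS2016) has the Hodge–Tate weights of (ρ⊗φ)|FL
(arXiv:2607.11763 Thm 1.2.1) and parallel gaps by Clozel1990's purity
lemma — so the gaps of ρ were equal. This reaches non-ordinary ρ and residually base-change /
dihedral / exceptional ρ̄, which Calegari's
tensor ψ = ρ⊗ρ^c (ψ̄ reducible there) cannot; the automorphic shadow of the twist is
HarrisSoudryTaylor1993. LEVER 2 (crux TensorSquareParallel):
Calegari2010 §2 upgraded from ordinary to potentially diagonalisable by BarnetlambEtAl2014 Thm C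
(GO(4), totally even multiplier) + the sign
theorem CaraianiLehung2016 (tr ψ(c) = ±2 ≠ 0) for the odd-gap-difference, non-base-change residue.
LEVER 3 (rank-2 crux EmptyWeightCore,
the hard core: residually base-change, odd gap difference, locally irreducible at some v ∣ p, where
parity kills every induction and ψ̄ is
reducible): TORSION-FED PATCHING IN AN AUTOMORPHICALLY EMPTY WEIGHT — non-parallel Serre weights σ_v
⊗ σ_v̄ (σ_v ≠ σ_v̄) of ρ̄ = ρ̄_f|Γ_F DO
carry torsion classes (weight part of Serre over F, Gee–Newton arXiv:1609.06965 / CaraianiNewton2023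
LGC), so the Calegari–Geraghty /
ACCGHLNSTT2023 §6 Fontaine–Laffaille patching runs with torsion-only input; R_∞ is a domain, the
patched module has full support, and since
H^*(X_K, V_λ)_𝔪 is TORSION for non-parallel λ (Harder) the global crystalline deformation ring of
weight λ has no ℚ̄_p-points: R^λ[1/p] = ∅
(CalegariGeraghty2017 philosophy "R = T with T torsion", Calegari survey arXiv:2109.14145 p. 22 fn.
44). Imported areas: potential
automorphy at defect zero (reached by functorial transport from defect one), CM Hecke characters,
torsion cohomology of Bianchi groups; no
analytic/probabilistic reformulation applies. No open route touches the non-parallel sector (43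
read); the closed draft route
SelfDefeatingInduction (card self-defeating-induction-exotic-weights) used untwisted induction +
Qian2022's ORDINARY theorem in the different
sector "non-CM quadratic extension of a CM field"; here the base is ℚ, the engine is polarised and
non-ordinary, and the twist is what
creates the polarisation.

RANKED CRUXES. #0 Target (target) — non-parallel weights are void: for F imaginary quadratic, p
prime, ρ : Γ_F → GL₂(ℚ̄_p) irreducible, a.e. unramified, de Rham at every v ∣ p with HT_τ(ρ|F_v) =
{a, b}, a < b, for every label (v, τ), there is one g with every HT multiset of the form {a, a + g}.
(why it might fail: False only if Fontaine–Mazur fails over an imaginary quadratic field (a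
geometric irreducible regular ρ of non-parallel weight; Calegari–Mazur/Childers families are not
known to contain algebraic non-parallel points); typing risk: the pinned datum's HT_τ
normalisation.) [CalegariMazur2008, Calegari2010, arXiv:2001.04956, arXiv:2109.14145]
#2 EmptyWeightCore (crux) — THE HARD CORE. F imaginary quadratic, p ≥ 11 split, ρ crystalline at
both v ∣ p, ρ̄|Γ_(F(ζ_p)) absolutely irreducible, ρ locally IRREDUCIBLE at some v ∣ p (no invariant
line), gap difference ODD, and ρ̄ of base-change type (ρ̄^τ ≅ ρ̄ ⊗ χ̄ for a lift τ of complex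
conjugation: trace/det form) ⇒ gaps equal. Mechanism: torsion-fed Calegari–Geraghty/ACC+
Fontaine–Laffaille patching in the automorphically empty non-parallel weight λ — non-parallel Serre
weights of ρ̄ carry torsion (weight part of Serre over F), R_∞ domain + full support +
H^*(X_K,V_λ)_𝔪 torsion ⇒ R^λ_(ρ̄,S)[1/p] = ∅. [difficulty: open-problem] (why it might fail: Outside
the Fontaine–Laffaille range (gap ≥ p − 1) no torsion-fed patching exists (would need change of
weight at defect one); existence of torsion in the needed non-parallel Serre weight (Gee–Newton) is
conditional on LGC hypotheses at small/ramified p.) [CalegariGeraghty2017, ACCGHLNSTT2023,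
arXiv:1609.06965, CaraianiNewton2023, arXiv:2607.11763, arXiv:2109.14145]
#3 TwistedInductionParallel (crux) — THE NEW LEVER. F imaginary quadratic, p ≥ 11 split in F, ρ
crystalline at both v ∣ p, ρ̄|Γ_(F(ζ_p)) absolutely irreducible, gap difference EVEN ⇒ gaps equal.
Proof plan: φ algebraic Hecke character of type (a, b) with 2(b − a) = gap difference and generic
finite part; I = Ind_(Γ_F)^(Γ_ℚ)(ρ⊗φ) is regular, odd-symplectic, potentially diagonalisable,
residually irreducible over ℚ(ζ_p); BLGGT Thm C ⇒ I|Γ_L automorphic (L totally real); I ≅ I⊗η ⇒ AI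
from a regular algebraic cuspidal π′ on GL₂/FL; HT weights of r(π′) + Clozel purity ⇒ equal gaps.
[difficulty: L] (why it might fail: Needs potential diagonalisability of every 2-dimensional
crystalline representation of Γ_(ℚ_p) with distinct weights (Kisin components + ordinary/induced
base points; believed known, else route WachComponentCensus) and the exact residual-irreducibility
bookkeeping for Ind over ℚ(ζ_p).) [BarnetlambEtAl2014, ArthurClozelAMS120,
HarrisLanTaylorThorneRMS2016, arXiv:2607.11763, Clozel1990, HarrisSoudryTaylor1993, Kisin2009]
#4 TensorSquareParallel (crux) — CALEGARI'S TENSOR, NON-ORDINARY. F imaginary quadratic, p ≥ 11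
split, ρ crystalline at both v ∣ p, ρ̄|Γ_(F(ζ_p)) absolutely irreducible, gap difference ODD, ρ̄ NOT
of base-change type ⇒ gaps equal. Proof plan: ψ = tensor induction of ρ to Γ_ℚ (restriction ρ⊗ρ^c,
weights {0, m, n, m+n} shifted, regular iff m ≠ n), orthogonal with totally even multiplier,
potentially diagonalisable; BLGGT Thm C ⇒ potentially automorphic ⇒ Caraiani–Le Hung sign theorem
forces tr ψ(c) = 0, but tr ψ(c) = ±2 (or: Calegari's ∧²/AI route to a GL₃/F form of Cartan-unstable
infinity type). [difficulty: M] (why it might fail: ψ̄|Γ_(ℚ(ζ_p)) may be reducible although ρ̄ is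
not a conjugate-twist over Γ_F (residually dihedral ρ̄|Γ_(F(ζ_p)) with ρ̄^c a twist only over the
cyclotomic subgroup) — that corner needs CM/dihedral methods instead.) [Calegari2010,
BarnetlambEtAl2014, CaraianiLehung2016, ArthurClozelAMS120]
#5 LocallyReducibleParallel (crux) — THE NEARLY ORDINARY SECTOR. F imaginary quadratic, any p, ρ as
in Target with an invariant line at EVERY v ∣ p (nearly ordinary in Calegari–Mazur's sense, any
residual image) ⇒ gaps equal. Known for ι-ordinary ρ with big image (Calegari2010 Thm 1.4;
ACCGHLNSTT2023 Thm 6.1.2 + Rem 6.1.3: Hida-theoretic lifting makes ρ contribute to ordinary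
completed cohomology, whose classical points have parallel weight); open for residually reducible /
dihedral ρ̄ and p non-split. [difficulty: L] (why it might fail: Residually reducible nearly
ordinary ρ over F need a Skinner–Wiles engine at defect one in a weight with no cusp forms
(Eisenstein torsion only); p inert/ramified nearly ordinary cases lack the 'F ⊇ imaginary quadratic
with p split' hypothesis of ACC+.) [Calegari2010, ACCGHLNSTT2023, CalegariMazur2008,
CalegariGeraghty2017]
#6 ResidueParallel (crux) — THE RESIDUE. F imaginary quadratic, ρ as in Target, locally irreducible
at some v ∣ p, and NOT in the good regime (p ≤ 7, or p inert/ramified, or ρ only potentially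
crystalline at some v ∣ p, or ρ̄|Γ_(F(ζ_p)) absolutely reducible) ⇒ gaps equal. For p inert the
twisted-induction lever applies verbatim given potential diagonalisability of 2-dimensional
crystalline representations of Γ_(ℚ_(p²)) (route WachComponentCensus); potentially crystalline ρ
need PD of potentially crystalline 2-dimensional representations; residually reducible non-ordinary
ρ are the genuinely dark corner. [difficulty: open-problem] (why it might fail: Residually
reducible, locally irreducible (supersingular) non-parallel ρ have no lever at all (no residually
reducible potentially-diagonalisable lifting, no Eisenstein torsion engine off the ordinary locus);
p = 2, 3 escape every cited theorem.) [Kisin2009, BarnetlambEtAl2014, CalegariMazur2008,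
arXiv:2001.04956]
#9 VoidToLanglands (support) — OUT-OF-SCOPE REMAINDER Target → Langlands, declared and NOT claimed
(D-0027 §2.1 pattern): everything in the summit beyond the vacuity of (B) on the non-parallel sector
for n = 2 over imaginary quadratic fields. Not to be staffed from this route. [difficulty:
open-problem] [BuzzardGeeLMS2014, CalegariMazur2008]

TWO-LAYER PLAN. Foreseen glued splits (not filed now): TwistedInductionParallel ⇐
(TwoDimCrystallinePD: 2-dimensional crystalline representations of
Γ_(ℚ_p) with distinct weights are potentially diagonalisable) → (InducedPotentialAutomorphy: BLGGT
Thm C for I = Ind(ρ⊗φ) + AI fibre) →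
TwistedInductionParallel; EmptyWeightCore ⇐ (NonParallelSerreWeightTorsion: ρ̄ modular of the
non-parallel Serre weight) →
(TorsionFedEmptiness: FL patching with torsion input ⇒ R^λ[1/p] = ∅) → EmptyWeightCore.

KILL CRITERIA. A non-parallel geometric ρ exhibited anywhere (refuting Target) closes the route
`refuted:Target` and is a counterexample to Fontaine–Mazur
— record and celebrate. TwistedInductionParallel refuted AS TYPED can only be a typing slip (HT
normalisation / the split predicate) ⇒
restate once. If a refuter shows the torsion-fed patching of EmptyWeightCore cannot run even in the
Fontaine–Laffaille range (e.g. the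
needed non-parallel Serre weight is provably non-modular for ρ̄_f|Γ_F), pivot EmptyWeightCore to the
ordinary-family route of
CalegariMazur2008 §2.4 (partial weight space, flatness of T) or retire it `exhausted`. If
LocallyReducibleParallel's residually reducible
part is refuted as typed, split off the big-image ordinary case (known) as support and re-rank.

NOT DECOMPOSED YET. The PD lemma for 2-dimensional crystalline Γ_(ℚ_p)-representations, the
existence of algebraic Hecke characters of arbitrary infinity type
(a, b) with prescribed generic finite part, the Ind/tensor-induction bookkeeping (HT of Ind = union;
odd symplectic pairing; residual
irreducibility over ℚ(ζ_p)), the AI-fibre step (I ≅ I⊗η ⇒ AI, Arthur–Clozel) and the purity step are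
layer-2 children of
TwistedInductionParallel / TensorSquareParallel; the weight-part-of-Serre input and the torsion
patching are children of EmptyWeightCore.
General CM fields F (more parity side conditions from the unit theorem) and n ≥ 3 (Hodge symmetry
HT_τc = w − HT_τ) are deliberately out.

CHEAPEST FALSIFIER. Lookup, done (arXiv:1010.2561 p. 4, Theorem 3 = Thm C): BLGGT's
single-representation potential automorphy over a totally real field
allows "r maps to GSp_n with totally odd multiplier OR to GO(n) with totally even multiplier", needs
only potential diagonalisability,
regularity and IRREDUCIBILITY of r̄|Γ_(F(ζ_l)) for l ≥ 2(n+1) — exactly what the twisted induction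
(GSp₄, odd) and the tensor square
(GO₄, even) supply; and the parity–regularity coincidence (det(ρ⊗φ) conjugation-invariant ⇔ 2(b−a) =
m−n ⇒ {a, a+m, b, b+n} distinct
unless m = n) is a two-line check. The one computation that would kill the LINE is a single explicit
non-parallel crystalline ρ over ℚ(i)
(none is known; Calegari–Mazur/Childers families are p-adic analytic curves meeting the integral
non-parallel lattice at most discretely).

NUMBERS. l ≥ 2(n+1) with n = 4 ⇒ p ≥ 11 (BarnetlambEtAl2014 Thm C); Fontaine–Laffaille range for
EmptyWeightCore: all gaps ≤ p − 2
(ACCGHLNSTT2023 Thm 6.1.1); Calegari2010 Thm 1.4: p > 7 split, ordinary, SL₂(𝔽_p) ⊂ im ρ̄, Proj ρ̄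
not extending to Γ_ℚ.

DEFINITION REQUESTS. None needed to state the items (labelled Hodge–Tate weights, residual
representations, outer conjugation, invariant flags, crystalline
predicate and induction are in the tree). Facts provers will want as named hypotheses: BLGGT Thm C
(single-r potential automorphy,
totally real base, GSp/GO alternative); Arthur–Clozel AI characterisation (Π ≅ Π⊗η ⇔ induced);
Clozel purity lemma for regular algebraic
cuspidal π over CM fields; HT weights of r_ι(π) (arXiv:2607.11763 Thm 1.2.1); existence of algebraic
Hecke characters of type (a, b) over
imaginary quadratic fields.

Novelty: Searches (2026-08-16): lit frontier Langlands --since 2023/2024 (local graph, 200 rows read); lit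
read arXiv:2607.11763 (ACHT-W 2026, pp.
1–8, 111–112), arXiv:2301.10509 (Caraiani–Newton pp. 3–7), arXiv:2109.14145 (Calegari survey §12, p.
22), arXiv:0708.2451 (Calegari–Mazur
§1, §2.4), arXiv:0907.3427 (Calegari 2010 pp. 1–6), arXiv:2001.04956 (Childers §1), arXiv:1010.2561
(BLGGT p. 4), arXiv:1812.09999 (ACC+
Thm 6.1.1–6.1.2, Rem 6.1.3), arXiv:1411.7661 (Allen), arXiv:2502.20645 (BCGP 2025 §1),
arXiv:2603.19768, arXiv:2605.03519,
arXiv:2309.01871, arXiv:1207.4224, arXiv:1609.06965; lit search --source arxiv "non-parallel weight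
Galois representations" (5 rows: Calegari
2010, Childers 2020 relevant), "Galois representations imaginary quadratic fields parallel weight"
(2 rows), "tensor induction complex
conjugation automorphic" (0), "odd Galois representations CM fields sign complex conjugation Asai"
(0); lit galaxy search "non-parallel
weight" --star all (2 rows, irrelevant), "polarized automorphic Galois representations and adjoint
Selmer groups" --star all (2 rows,
irrelevant); tree: grep of all 66 Theses for parallel/induction (only the closed draft
SelfDefeatingInduction), ledger negatives (1, unrelated).
Nearest prior art found: Calegari2010 = arXiv:0907.3427 Thm 1.4 (ordinary non-parallel, SL₂-image,
non-base-change: tensor ρ⊗ρ^c + [BLGHT]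
Thm 7.5 + ∧²/AI + Borel–Wallach); ACCGHLNSTT2023 Rem 6.1.3 (ordinary, enormous image);
CalegariMazur2008 Conj 1.3 (Artin case under S  [refs: 2607.11763, 2301.10509, 2109.14145, 0708.2451, 0907.3427, 2001.04956, 1010.2561, 1812.09999, 1411.7661, 2502.20645, 2603.19768, 2605.03519, 2309.01871, 1207.4224, 1609.06965, Calegari2010, ACCGHLNSTT2023, CalegariMazur2008, Qian2022]

Barriers (technique_class: potential-automorphy induction torsion-patching): - technique_class: potential-automorphy induction torsion-patching
- Literature.Barriers.Langlands.NonRegularWeightBarrier: USED, not evaded — non-parallelness is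
exactly what makes the induced/tensored representation Hodge–Tate regular, so regular-weight
potential automorphy applies; parallel ρ (the barrier's protected species) make Ind irregular and
are not claimed.
- Literature.Barriers.Langlands.TaylorWilesNumericalCoincidence: evaded in cruxes 3–4 by functorial
transport from defect l₀ = 1 (GL₂/F) to defect 0 (GSp₄, GO₄ over ℚ and totally real L); confronted
head-on only in EmptyWeightCore, where the Calegari–Geraghty complexes are the tool and the ABSENCE
of automorphic forms is the conclusion sought.
- Literature.Barriers.Langlands.TwistedEndoscopySelfDual: evaded — the self-duality needed by the
defect-0 engines is manufactured by the twist (Ind(ρ⊗φ) symplectic, ρ⊗ρ^c orthogonal) although ρ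
itself is never polarisable (non-parallel ρ^c is no twist of ρ).
- Literature.Barriers.Langlands.PatchingLocalComponentBarrier: respected — potential
diagonalisability is a hypothesis met for free at split p (2-dimensional crystalline over ℚ_p);
non-split p is parked in ResidueParallel with the pointer to WachComponentCensus.
- Literature.Barriers.Langlands.ResiduallyReducibleBarrier: it does not evade it; the bet is that
residually reducible non-parallel ρ are reachable on the nearly ordinary locus by Eisenstein/Hida
methods (LocallyReducibleParallel) and are honestly dark off it

History (route lifecycle, newest last):
- 2026-08-16T21:53:47Z · rev 2: restated VoidToLanglands (stmt-Langlands-17004) — hygiene: VoidToLanglands restated with the Target antecedent inlined verbatim (definitionally equal; avoids cross-route signature dedupe of the bare 'Target → L (planner-plan-novel-Langlands-Langlands-e266a39d-a-v2-g9-0)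
- 2026-08-16T22:02:38Z · rev 3: restated EmptyWeightCore (stmt-Langlands-16999), TensorSquareParallel (stmt-Langlands-17001) — cone repair: import Literature…AbsGaloisOuterConj dropped (it alone dragged LAdicRepFrobenius→FrobeniusDensity→TunnellLemma→StrongArtinGL2/LanglandsTunnell/Swee (planner-rrepair-Langlands-NonParallelVoid-4d345d27-0)
- 2026-08-25T08:56:21Z · DORMANT — reconciler: no traction for 7.6 d (last activity item-evidence-added at 2026-08-17T19:07:57Z); parked, not closed — `ledger route dormant route-Langlands-NonPar (operator:999:2928755)

sub-problem: Langlands · status: dormant · opened planner-plan-novel-Langlands-Langlands-e266a39d-a-v2-g9-0 2026-08-16T21:52:26Z · rev 3 · ledger route-Langlands-NonParallelVoid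
GENERATED by the gate from the ledger (D-0016/17). Provers cite these decls: `theorem foo : Summit.Langlands.Langlands.Theses.NonParallelVoid.<Decl> := …` in Summits/Langlands/Langlands/Theorems/<Name>.lean.
-/

namespace Summit.Langlands.Langlands.Theses.NonParallelVoid

open scoped BigOperators Topology Manifold Classical MeasureTheory ProbabilityTheory Matrix InnerProductSpace ComplexConjugate ContinuousMap
open Filter Set Function TopologicalSpace MeasureTheory

attribute [summit_statement] _root_.Langlands

/-- item stmt-Langlands-16998 · target · rank 0 · open · by planner
why it might fail: False only if Fontaine–Mazur fails over an imaginary quadratic field (a geometric irreducible regular ρ of non-parallel weight; Calegari–Mazur/Childers families are not known to contain algebraic non-parallel points); typing risk: the pinned datum's HT_τ normalisation.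
sources: CalegariMazur2008, Calegari2010, arXiv:2001.04956, arXiv:2109.14145
[target] non-parallel weights are void: for F imaginary quadratic, p prime, ρ : Γ_F → GL₂(ℚ̄_p)
irreducible, a.e. unramified, de Rham at every v ∣ p with HT_τ(ρ|F_v) = {a, b}, a < b, for every
label (v, τ), there is one g with every HT multiset of the form {a, a + g}. -/
@[route_item "route-Langlands-NonParallelVoid"]
def Target : Prop :=
  ∀ (F : Type) [Field F] [NumberField F] [Algebra.IsQuadraticExtension ℚ F], NumberField.IsTotallyComplex F → ∀ (p : ℕ) [Fact p.Prime] (ρ : Literature.NumberTheory.GaloisRepresentations.FramedGaloisRep F (PadicAlgCl p) 2), ρ.toGaloisRep.IsIrreducible → (∀ᶠ v : IsDedekindDomain.HeightOneSpectrum (NumberField.RingOfIntegers F) in Filter.cofinite, ρ.IsUnramifiedAt v) → (∀ (v : IsDedekindDomain.HeightOneSpectrum (NumberField.RingOfIntegers F)) (hv : ((p : ℕ) : NumberField.RingOfIntegers F) ∈ v.asIdeal), (Literature.NumberTheory.PAdicHodge.fontainePstAdicCompletion v p hv).IsDeRhamFramed (ρ.toLocal v) ∧ (letI := (Literature.NumberTheory.PAdicHodge.fontainePstAdicCompletion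 v p hv).algebra; ∀ τ : v.adicCompletion F →ₐ[ℚ_[p]] PadicAlgCl p, ∃ a b : ℤ, a < b ∧ ρ.labelledHodgeTateWeightsAt v (Literature.NumberTheory.PAdicHodge.fontainePstAdicCompletion v p hv).algebra (Literature.NumberTheory.PAdicHodge.fontainePstAdicCompletion v p hv).𝔅 τ.toRingHom = {a, b})) → ∃ g : ℤ, ∀ (v : IsDedekindDomain.HeightOneSpectrum (NumberField.RingOfIntegers F)) (hv : ((p : ℕ) : NumberField.RingOfIntegers F) ∈ v.asIdeal), letI := (Literature.NumberTheory.PAdicHodge.fontainePstAdicCompletion v p hv).algebra; ∀ τ : v.adicCompletion F →ₐ[ℚ_[p]] PadicAlgCl p, ∃ a : ℤ, ρ.labelledHodgeTateWeightsAt v (Literature.NumberTheory.PAdicHodge.fontainePstAdicCompletion v p hv).algebra (Literature.NumberTheory.PAdicHodge.fontainePstAdicCompletion v p hv).𝔅 τ.toRingHom = {a, a + g}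

-- earlier EmptyWeightCore (stmt-Langlands-16999, replaced 2026-08-16T22:02:38Z -> stmt-Langlands-17008): retired by None — ∀ (F : Type) [Field F] [NumberField F] [Algebra.IsQuadraticExtension ℚ F], NumberField.IsTotallyComplex F → ∀ (p : ℕ) [Fact p.Prime] (ρ : Literature.NumberTheory.GaloisRepresentations.FramedGaloisRep F (PadicAlgCl p) 2), ρ.toGaloisRep.IsIrreducible → (∀ᶠ v : IsDedekindDomain.Hei
/-- item stmt-Langlands-17008 · crux · rank 2 · open · by planner
why it might fail: Outside the Fontaine–Laffaille range (gap ≥ p − 1) no torsion-fed patching exists (would need change of weight at defect one); existence of torsion in the needed non-parallel Serre weight (Gee–Newton) is conditional on LGC hypotheses at small/ramified p.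
sources: CalegariGeraghty2017, ACCGHLNSTT2023, arXiv:1609.06965, CaraianiNewton2023, arXiv:2607.11763, arXiv:2109.14145
[crux] THE HARD CORE. F imaginary quadratic, p ≥ 11 split, ρ crystalline at both v ∣ p,
ρ̄|Γ_(F(ζ_p)) absolutely irreducible, ρ locally IRREDUCIBLE at some v ∣ p (no invariant line), gap
difference ODD, and ρ̄ of base-change type (ρ̄ of base-change type, trace/det form stated through
absGaloisRestrict only: for some τ ∈ Γ_ℚ outside res(Γ_F) and a character χ̄, tr ρ̄(σ') = χ̄(σ)·tr
ρ̄(σ) and det ρ̄(σ') = χ̄(σ)²·det ρ̄(σ) whenever res σ' = τ·res σ·τ⁻¹, i.e. σ' = θ_τ(σ) and ρ̄^τ ≅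
ρ̄ ⊗ χ̄) ⇒ gaps equal. Mechanism: torsion-fed Calegari–Geraghty/ACC+ Fontaine–Laffaille patching in
the automorphically empty non-parallel weight λ — non-parallel Serre weights of ρ̄ carry torsion
(weight part of Serre over F), R_∞ domain + full support + H^*(X_K,V_λ)_𝔪 torsion ⇒ R^λ_(ρ̄,S)[1/p]
= ∅. [difficulty: open-problem] -/
@[route_item "route-Langlands-NonParallelVoid", crux]
def EmptyWeightCore : Prop :=
  ∀ (F : Type) [Field F] [NumberField F] [Algebra.IsQuadraticExtension ℚ F], NumberField.IsTotallyComplex F → ∀ (p : ℕ) [Fact p.Prime] (ρ : Literature.NumberTheory.GaloisRepresentations.FramedGaloisRep F (PadicAlgCl p) 2), ρ.toGaloisRep.IsIrreducible → (∀ᶠ v : IsDedekindDomain.HeightOneSpectrum (NumberField.RingOfIntegers F) in Filter.cofinite, ρ.IsUnramifiedAt v) → (∀ (v : IsDedekindDomain.HeightOneSpectrum (NumberField.RingOfIntegers F)) (hv : ((p : ℕ) : NumberField.RingOfIntegers F) ∈ v.asIdeal), (Literature.NumberTheory.PAdicHodge.fontainePstAdicCompletion v p hv).IsDeRhamFramed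 (ρ.toLocal v) ∧ (letI := (Literature.NumberTheory.PAdicHodge.fontainePstAdicCompletion v p hv).algebra; ∀ τ : v.adicCompletion F →ₐ[ℚ_[p]] PadicAlgCl p, ∃ a b : ℤ, a < b ∧ ρ.labelledHodgeTateWeightsAt v (Literature.NumberTheory.PAdicHodge.fontainePstAdicCompletion v p hv).algebra (Literature.NumberTheory.PAdicHodge.fontainePstAdicCompletion v p hv).𝔅 τ.toRingHom = {a, b})) → ¬ (∀ v : IsDedekindDomain.HeightOneSpectrum (NumberField.RingOfIntegers F), ((p : ℕ) : NumberField.RingOfIntegers F) ∈ v.asIdeal → Literature.NumberTheory.GaloisRepresentations.FramedRep.HasInvariantCompleteFlag (ρ.toLocal v)) → (11 ≤ p ∧ (∃ v w : IsDedekindDomain.HeightOneSpectrum (NumberField.RingOfIntegers F), v ≠ w ∧ ((p : ℕ) : NumberField.RingOfIntegers F) ∈ v.asIdeal ∧ ((p : ℕ) : NumberField.RingOfIntegers F) ∈ w.asIdeal) ∧ (∀ (v : IsDedekindDomain.HeightOneSpectrum (NumberField.RingOfIntegers F)) (hv : ((p : ℕ) : NumberField.RingOfIntegers F) ∈ v.asIdeal),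 (Literature.NumberTheory.PAdicHodge.fontainePstAdicCompletion v p hv).IsCrystallineFramed (ρ.toLocal v)) ∧ Literature.NumberTheory.GaloisRepresentations.FramedGaloisRep.IsResiduallyAbsIrreducible (ρ.restrictField (CyclotomicField p F))) → ¬ (∀ (v : IsDedekindDomain.HeightOneSpectrum (NumberField.RingOfIntegers F)) (hv : ((p : ℕ) : NumberField.RingOfIntegers F) ∈ v.asIdeal) (w : IsDedekindDomain.HeightOneSpectrum (NumberField.RingOfIntegers F)) (hw : ((p : ℕ) : NumberField.RingOfIntegers F) ∈ w.asIdeal), letI := (Literature.NumberTheory.PAdicHodge.fontainePstAdicCompletion v p hv).algebra; letI := (Literature.NumberTheory.PAdicHodge.fontainePstAdicCompletion w p hw).algebra; ∀ (τ : v.adicCompletion F →ₐ[ℚ_[p]] PadicAlgCl p) (σ : w.adicCompletion F →ₐ[ℚ_[p]] PadicAlgCl p) (a b a' b' : ℤ), ρ.labelledHodgeTateWeightsAt v (Literature.NumberTheory.PAdicHodge.fontainePstAdicCompletion v p hv).algebra (Literature.NumberTheory.PAdicHodge.fontainePstAdicCompletion v p hv).𝔅 τ.toRingHom = {a, b} →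 a < b → ρ.labelledHodgeTateWeightsAt w (Literature.NumberTheory.PAdicHodge.fontainePstAdicCompletion w p hw).algebra (Literature.NumberTheory.PAdicHodge.fontainePstAdicCompletion w p hw).𝔅 σ.toRingHom = {a', b'} → a' < b' → Even (b - a + (b' - a'))) → (∃ τ : Field.absoluteGaloisGroup ℚ, τ ∉ Set.range (Literature.NumberTheory.GaloisRepresentations.absGaloisRestrict ℚ F) ∧ ∃ χ : Field.absoluteGaloisGroup F →* (Literature.NumberTheory.GaloisRepresentations.padicAlgClResidueField p)ˣ, ∀ σ σ' : Field.absoluteGaloisGroup F, Literature.NumberTheory.GaloisRepresentations.absGaloisRestrict ℚ F σ' = τ * Literature.NumberTheory.GaloisRepresentations.absGaloisRestrict ℚ F σ * τ⁻¹ → (ρ.residualRep σ').val.trace = (χ σ : Literature.NumberTheory.GaloisRepresentations.padicAlgClResidueField p) * (ρ.residualRep σ).val.trace ∧ (ρ.residualRep σ').val.det = (χ σ : Literature.NumberTheory.GaloisRepresentations.padicAlgClResidueField p) ^ 2 * (ρ.residualRep σ).val.det) → ∃ g : ℤ, ∀ (v : IsDedekindDomain.HeightOneSpectrum (NumberField.RingOfIntegers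 F)) (hv : ((p : ℕ) : NumberField.RingOfIntegers F) ∈ v.asIdeal), letI := (Literature.NumberTheory.PAdicHodge.fontainePstAdicCompletion v p hv).algebra; ∀ τ : v.adicCompletion F →ₐ[ℚ_[p]] PadicAlgCl p, ∃ a : ℤ, ρ.labelledHodgeTateWeightsAt v (Literature.NumberTheory.PAdicHodge.fontainePstAdicCompletion v p hv).algebra (Literature.NumberTheory.PAdicHodge.fontainePstAdicCompletion v p hv).𝔅 τ.toRingHom = {a, a + g}

/-- item stmt-Langlands-17000 · crux · rank 3 · open · by planner
why it might fail: Needs potential diagonalisability of every 2-dimensional crystalline representation of Γ_(ℚ_p) with distinct weights (Kisin components + ordinary/induced base points; believed known, else route WachComponentCensus) and the exact residual-irreducibility bookkeeping for Ind over ℚ(ζ_p).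
sources: BarnetlambEtAl2014, ArthurClozelAMS120, HarrisLanTaylorThorneRMS2016, arXiv:2607.11763, Clozel1990, HarrisSoudryTaylor1993
[crux] THE NEW LEVER. F imaginary quadratic, p ≥ 11 split in F, ρ crystalline at both v ∣ p,
ρ̄|Γ_(F(ζ_p)) absolutely irreducible, gap difference EVEN ⇒ gaps equal. Proof plan: φ algebraic
Hecke character of type (a, b) with 2(b − a) = gap difference and generic finite part; I =
Ind_(Γ_F)^(Γ_ℚ)(ρ⊗φ) is regular, odd-symplectic, potentially diagonalisable, residually irreducible
over ℚ(ζ_p); BLGGT Thm C ⇒ I|Γ_L automorphic (L totally real); I ≅ I⊗η ⇒ AI from a regular algebraic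
cuspidal π′ on GL₂/FL; HT weights of r(π′) + Clozel purity ⇒ equal gaps. [difficulty: L] -/
@[route_item "route-Langlands-NonParallelVoid", crux]
def TwistedInductionParallel : Prop :=
  ∀ (F : Type) [Field F] [NumberField F] [Algebra.IsQuadraticExtension ℚ F], NumberField.IsTotallyComplex F → ∀ (p : ℕ) [Fact p.Prime] (ρ : Literature.NumberTheory.GaloisRepresentations.FramedGaloisRep F (PadicAlgCl p) 2), ρ.toGaloisRep.IsIrreducible → (∀ᶠ v : IsDedekindDomain.HeightOneSpectrum (NumberField.RingOfIntegers F) in Filter.cofinite, ρ.IsUnramifiedAt v) → (∀ (v : IsDedekindDomain.HeightOneSpectrum (NumberField.RingOfIntegers F)) (hv : ((p : ℕ) : NumberField.RingOfIntegers F) ∈ v.asIdeal), (Literature.NumberTheory.PAdicHodge.fontainePstAdicCompletion v p hv).IsDeRhamFramed (ρ.toLocal v) ∧ (letI := (Literature.NumberTheory.PAdicHodge.fontainePstAdicCompletion v p hv).algebra; ∀ τ : v.adicCompletion F →ₐ[ℚ_[p]] PadicAlgCl p, ∃ a b : ℤ, a < b ∧ ρ.labelledHodgeTateWeightsAt v (Literature.NumberTheory.PAdicHodge.fontainePstAdicCompletion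 v p hv).algebra (Literature.NumberTheory.PAdicHodge.fontainePstAdicCompletion v p hv).𝔅 τ.toRingHom = {a, b})) → (11 ≤ p ∧ (∃ v w : IsDedekindDomain.HeightOneSpectrum (NumberField.RingOfIntegers F), v ≠ w ∧ ((p : ℕ) : NumberField.RingOfIntegers F) ∈ v.asIdeal ∧ ((p : ℕ) : NumberField.RingOfIntegers F) ∈ w.asIdeal) ∧ (∀ (v : IsDedekindDomain.HeightOneSpectrum (NumberField.RingOfIntegers F)) (hv : ((p : ℕ) : NumberField.RingOfIntegers F) ∈ v.asIdeal), (Literature.NumberTheory.PAdicHodge.fontainePstAdicCompletion v p hv).IsCrystallineFramed (ρ.toLocal v)) ∧ Literature.NumberTheory.GaloisRepresentations.FramedGaloisRep.IsResiduallyAbsIrreducible (ρ.restrictField (CyclotomicField p F))) → (∀ (v : IsDedekindDomain.HeightOneSpectrum (NumberField.RingOfIntegers F)) (hv : ((p : ℕ) : NumberField.RingOfIntegers F) ∈ v.asIdeal) (w : IsDedekindDomain.HeightOneSpectrum (NumberField.RingOfIntegers F)) (hw : ((p : ℕ) : NumberField.RingOfIntegers F) ∈ w.asIdeal), letI := (Literature.NumberTheory.PAdicHodge.fontainePstAdicCompletion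 v p hv).algebra; letI := (Literature.NumberTheory.PAdicHodge.fontainePstAdicCompletion w p hw).algebra; ∀ (τ : v.adicCompletion F →ₐ[ℚ_[p]] PadicAlgCl p) (σ : w.adicCompletion F →ₐ[ℚ_[p]] PadicAlgCl p) (a b a' b' : ℤ), ρ.labelledHodgeTateWeightsAt v (Literature.NumberTheory.PAdicHodge.fontainePstAdicCompletion v p hv).algebra (Literature.NumberTheory.PAdicHodge.fontainePstAdicCompletion v p hv).𝔅 τ.toRingHom = {a, b} → a < b → ρ.labelledHodgeTateWeightsAt w (Literature.NumberTheory.PAdicHodge.fontainePstAdicCompletion w p hw).algebra (Literature.NumberTheory.PAdicHodge.fontainePstAdicCompletion w p hw).𝔅 σ.toRingHom = {a', b'} → a' < b' → Even (b - a + (b' - a'))) → ∃ g : ℤ, ∀ (v : IsDedekindDomain.HeightOneSpectrum (NumberField.RingOfIntegers F)) (hv : ((p : ℕ) : NumberField.RingOfIntegers F) ∈ v.asIdeal), letI := (Literature.NumberTheory.PAdicHodge.fontainePstAdicCompletion v p hv).algebra; ∀ τ : v.adicCompletion F →ₐ[ℚ_[p]] PadicAlgCl p, ∃ a : ℤ,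 ρ.labelledHodgeTateWeightsAt v (Literature.NumberTheory.PAdicHodge.fontainePstAdicCompletion v p hv).algebra (Literature.NumberTheory.PAdicHodge.fontainePstAdicCompletion v p hv).𝔅 τ.toRingHom = {a, a + g}

-- earlier TensorSquareParallel (stmt-Langlands-17001, replaced 2026-08-16T22:02:38Z -> stmt-Langlands-17009): retired by None — ∀ (F : Type) [Field F] [NumberField F] [Algebra.IsQuadraticExtension ℚ F], NumberField.IsTotallyComplex F → ∀ (p : ℕ) [Fact p.Prime] (ρ : Literature.NumberTheory.GaloisRepresentations.FramedGaloisRep F (PadicAlgCl p) 2), ρ.toGaloisRep.IsIrreducible → (∀ᶠ v : IsDedekindDomai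
/-- item stmt-Langlands-17009 · crux · rank 4 · open · by planner
why it might fail: ψ̄|Γ_(ℚ(ζ_p)) may be reducible although ρ̄ is not a conjugate-twist over Γ_F (residually dihedral ρ̄|Γ_(F(ζ_p)) with ρ̄^c a twist only over the cyclotomic subgroup) — that corner needs CM/dihedral methods instead.
sources: Calegari2010, BarnetlambEtAl2014, CaraianiLehung2016, ArthurClozelAMS120
[crux] CALEGARI'S TENSOR, NON-ORDINARY. F imaginary quadratic, p ≥ 11 split, ρ crystalline at both v
∣ p, ρ̄|Γ_(F(ζ_p)) absolutely irreducible, gap difference ODD, ρ̄ NOT of base-change type (negation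
of the absGaloisRestrict trace/det predicate of EmptyWeightCore) ⇒ gaps equal. Proof plan: ψ =
tensor induction of ρ to Γ_ℚ (restriction ρ⊗ρ^c, weights {0, m, n, m+n} shifted, regular iff m ≠ n),
orthogonal with totally even multiplier, potentially diagonalisable; BLGGT Thm C ⇒ potentially
automorphic ⇒ Caraiani–Le Hung sign theorem forces tr ψ(c) = 0, but tr ψ(c) = ±2 (or: Calegari's
∧²/AI route to a GL₃/F form of Cartan-unstable infinity type). [difficulty: M] -/
@[route_item "route-Langlands-NonParallelVoid", crux]
def TensorSquareParallel : Prop :=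
  ∀ (F : Type) [Field F] [NumberField F] [Algebra.IsQuadraticExtension ℚ F], NumberField.IsTotallyComplex F → ∀ (p : ℕ) [Fact p.Prime] (ρ : Literature.NumberTheory.GaloisRepresentations.FramedGaloisRep F (PadicAlgCl p) 2), ρ.toGaloisRep.IsIrreducible → (∀ᶠ v : IsDedekindDomain.HeightOneSpectrum (NumberField.RingOfIntegers F) in Filter.cofinite, ρ.IsUnramifiedAt v) → (∀ (v : IsDedekindDomain.HeightOneSpectrum (NumberField.RingOfIntegers F)) (hv : ((p : ℕ) : NumberField.RingOfIntegers F) ∈ v.asIdeal), (Literature.NumberTheory.PAdicHodge.fontainePstAdicCompletion v p hv).IsDeRhamFramed (ρ.toLocal v) ∧ (letI := (Literature.NumberTheory.PAdicHodge.fontainePstAdicCompletion v p hv).algebra; ∀ τ : v.adicCompletion F →ₐ[ℚ_[p]] PadicAlgCl p, ∃ a b : ℤ, a < b ∧ ρ.labelledHodgeTateWeightsAt v (Literature.NumberTheory.PAdicHodge.fontainePstAdicCompletion v p hv).algebra (Literature.NumberTheory.PAdicHodge.fontainePstAdicCompletion v p hv).𝔅 τ.toRingHom = {a, b})) → (11 ≤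 p ∧ (∃ v w : IsDedekindDomain.HeightOneSpectrum (NumberField.RingOfIntegers F), v ≠ w ∧ ((p : ℕ) : NumberField.RingOfIntegers F) ∈ v.asIdeal ∧ ((p : ℕ) : NumberField.RingOfIntegers F) ∈ w.asIdeal) ∧ (∀ (v : IsDedekindDomain.HeightOneSpectrum (NumberField.RingOfIntegers F)) (hv : ((p : ℕ) : NumberField.RingOfIntegers F) ∈ v.asIdeal), (Literature.NumberTheory.PAdicHodge.fontainePstAdicCompletion v p hv).IsCrystallineFramed (ρ.toLocal v)) ∧ Literature.NumberTheory.GaloisRepresentations.FramedGaloisRep.IsResiduallyAbsIrreducible (ρ.restrictField (CyclotomicField p F))) → ¬ (∀ (v : IsDedekindDomain.HeightOneSpectrum (NumberField.RingOfIntegers F)) (hv : ((p : ℕ) : NumberField.RingOfIntegers F) ∈ v.asIdeal) (w : IsDedekindDomain.HeightOneSpectrum (NumberField.RingOfIntegers F)) (hw : ((p : ℕ) : NumberField.RingOfIntegers F) ∈ w.asIdeal), letI := (Literature.NumberTheory.PAdicHodge.fontainePstAdicCompletion v p hv).algebra; letI := (Literature.NumberTheory.PAdicHodge.fontainePstAdicCompletion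 w p hw).algebra; ∀ (τ : v.adicCompletion F →ₐ[ℚ_[p]] PadicAlgCl p) (σ : w.adicCompletion F →ₐ[ℚ_[p]] PadicAlgCl p) (a b a' b' : ℤ), ρ.labelledHodgeTateWeightsAt v (Literature.NumberTheory.PAdicHodge.fontainePstAdicCompletion v p hv).algebra (Literature.NumberTheory.PAdicHodge.fontainePstAdicCompletion v p hv).𝔅 τ.toRingHom = {a, b} → a < b → ρ.labelledHodgeTateWeightsAt w (Literature.NumberTheory.PAdicHodge.fontainePstAdicCompletion w p hw).algebra (Literature.NumberTheory.PAdicHodge.fontainePstAdicCompletion w p hw).𝔅 σ.toRingHom = {a', b'} → a' < b' → Even (b - a + (b' - a'))) → ¬ (∃ τ : Field.absoluteGaloisGroup ℚ, τ ∉ Set.range (Literature.NumberTheory.GaloisRepresentations.absGaloisRestrict ℚ F) ∧ ∃ χ : Field.absoluteGaloisGroup F →* (Literature.NumberTheory.GaloisRepresentations.padicAlgClResidueField p)ˣ, ∀ σ σ' : Field.absoluteGaloisGroup F, Literature.NumberTheory.GaloisRepresentations.absGaloisRestrict ℚ F σ' = τ * Literature.NumberTheory.GaloisRepresentations.absGaloisRestrict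 ℚ F σ * τ⁻¹ → (ρ.residualRep σ').val.trace = (χ σ : Literature.NumberTheory.GaloisRepresentations.padicAlgClResidueField p) * (ρ.residualRep σ).val.trace ∧ (ρ.residualRep σ').val.det = (χ σ : Literature.NumberTheory.GaloisRepresentations.padicAlgClResidueField p) ^ 2 * (ρ.residualRep σ).val.det) → ∃ g : ℤ, ∀ (v : IsDedekindDomain.HeightOneSpectrum (NumberField.RingOfIntegers F)) (hv : ((p : ℕ) : NumberField.RingOfIntegers F) ∈ v.asIdeal), letI := (Literature.NumberTheory.PAdicHodge.fontainePstAdicCompletion v p hv).algebra; ∀ τ : v.adicCompletion F →ₐ[ℚ_[p]] PadicAlgCl p, ∃ a : ℤ, ρ.labelledHodgeTateWeightsAt v (Literature.NumberTheory.PAdicHodge.fontainePstAdicCompletion v p hv).algebra (Literature.NumberTheory.PAdicHodge.fontainePstAdicCompletion v p hv).𝔅 τ.toRingHom = {a, a + g}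

/-- item stmt-Langlands-17002 · crux · rank 5 · open · by planner
why it might fail: Residually reducible nearly ordinary ρ over F need a Skinner–Wiles engine at defect one in a weight with no cusp forms (Eisenstein torsion only); p inert/ramified nearly ordinary cases lack the 'F ⊇ imaginary quadratic with p split' hypothesis of ACC+.
sources: Calegari2010, ACCGHLNSTT2023, CalegariMazur2008, CalegariGeraghty2017
[crux] THE NEARLY ORDINARY SECTOR. F imaginary quadratic, any p, ρ as in Target with an invariant
line at EVERY v ∣ p (nearly ordinary in Calegari–Mazur's sense, any residual image) ⇒ gaps equal.
Known for ι-ordinary ρ with big image (Calegari2010 Thm 1.4; ACCGHLNSTT2023 Thm 6.1.2 + Rem 6.1.3: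
Hida-theoretic lifting makes ρ contribute to ordinary completed cohomology, whose classical points
have parallel weight); open for residually reducible / dihedral ρ̄ and p non-split. [difficulty: L] -/
@[route_item "route-Langlands-NonParallelVoid", crux]
def LocallyReducibleParallel : Prop :=
  ∀ (F : Type) [Field F] [NumberField F] [Algebra.IsQuadraticExtension ℚ F], NumberField.IsTotallyComplex F → ∀ (p : ℕ) [Fact p.Prime] (ρ : Literature.NumberTheory.GaloisRepresentations.FramedGaloisRep F (PadicAlgCl p) 2), ρ.toGaloisRep.IsIrreducible → (∀ᶠ v : IsDedekindDomain.HeightOneSpectrum (NumberField.RingOfIntegers F) in Filter.cofinite, ρ.IsUnramifiedAt v) → (∀ (v : IsDedekindDomain.HeightOneSpectrum (NumberField.RingOfIntegers F)) (hv : ((p : ℕ) : NumberField.RingOfIntegers F) ∈ v.asIdeal), (Literature.NumberTheory.PAdicHodge.fontainePstAdicCompletion v p hv).IsDeRhamFramed (ρ.toLocal v) ∧ (letI := (Literature.NumberTheory.PAdicHodge.fontainePstAdicCompletion v p hv).algebra; ∀ τ : v.adicCompletion F →ₐ[ℚ_[p]] PadicAlgCl p, ∃ a b : ℤ, a < b ∧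 ρ.labelledHodgeTateWeightsAt v (Literature.NumberTheory.PAdicHodge.fontainePstAdicCompletion v p hv).algebra (Literature.NumberTheory.PAdicHodge.fontainePstAdicCompletion v p hv).𝔅 τ.toRingHom = {a, b})) → (∀ v : IsDedekindDomain.HeightOneSpectrum (NumberField.RingOfIntegers F), ((p : ℕ) : NumberField.RingOfIntegers F) ∈ v.asIdeal → Literature.NumberTheory.GaloisRepresentations.FramedRep.HasInvariantCompleteFlag (ρ.toLocal v)) → ∃ g : ℤ, ∀ (v : IsDedekindDomain.HeightOneSpectrum (NumberField.RingOfIntegers F)) (hv : ((p : ℕ) : NumberField.RingOfIntegers F) ∈ v.asIdeal), letI := (Literature.NumberTheory.PAdicHodge.fontainePstAdicCompletion v p hv).algebra; ∀ τ : v.adicCompletion F →ₐ[ℚ_[p]] PadicAlgCl p, ∃ a : ℤ, ρ.labelledHodgeTateWeightsAt v (Literature.NumberTheory.PAdicHodge.fontainePstAdicCompletion v p hv).algebra (Literature.NumberTheory.PAdicHodge.fontainePstAdicCompletion v p hv).𝔅 τ.toRingHom = {a, a + g}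

/-- item stmt-Langlands-17003 · crux · rank 6 · open · by planner
why it might fail: Residually reducible, locally irreducible (supersingular) non-parallel ρ have no lever at all (no residually reducible potentially-diagonalisable lifting, no Eisenstein torsion engine off the ordinary locus); p = 2, 3 escape every cited theorem.
sources: Kisin2009, BarnetlambEtAl2014, CalegariMazur2008, arXiv:2001.04956
[crux] THE RESIDUE. F imaginary quadratic, ρ as in Target, locally irreducible at some v ∣ p, and
NOT in the good regime (p ≤ 7, or p inert/ramified, or ρ only potentially crystalline at some v ∣ p,
or ρ̄|Γ_(F(ζ_p)) absolutely reducible) ⇒ gaps equal. For p inert the twisted-induction lever applies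
verbatim given potential diagonalisability of 2-dimensional crystalline representations of
Γ_(ℚ_(p²)) (route WachComponentCensus); potentially crystalline ρ need PD of potentially crystalline
2-dimensional representations; residually reducible non-ordinary ρ are the genuinely dark corner.
[difficulty: open-problem] -/
@[route_item "route-Langlands-NonParallelVoid", crux]
def ResidueParallel : Prop :=
  ∀ (F : Type) [Field F] [NumberField F] [Algebra.IsQuadraticExtension ℚ F], NumberField.IsTotallyComplex F → ∀ (p : ℕ) [Fact p.Prime] (ρ : Literature.NumberTheory.GaloisRepresentations.FramedGaloisRep F (PadicAlgCl p) 2), ρ.toGaloisRep.IsIrreducible → (∀ᶠ v : IsDedekindDomain.HeightOneSpectrum (NumberField.RingOfIntegers F) in Filter.cofinite, ρ.IsUnramifiedAt v) → (∀ (v : IsDedekindDomain.HeightOneSpectrum (NumberField.RingOfIntegers F)) (hv : ((p : ℕ) : NumberField.RingOfIntegers F) ∈ v.asIdeal), (Literature.NumberTheory.PAdicHodge.fontainePstAdicCompletion v p hv).IsDeRhamFramed (ρ.toLocal v) ∧ (letI := (Literature.NumberTheory.PAdicHodge.fontainePstAdicCompletion v p hv).algebra; ∀ τ : v.adicCompletion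 F →ₐ[ℚ_[p]] PadicAlgCl p, ∃ a b : ℤ, a < b ∧ ρ.labelledHodgeTateWeightsAt v (Literature.NumberTheory.PAdicHodge.fontainePstAdicCompletion v p hv).algebra (Literature.NumberTheory.PAdicHodge.fontainePstAdicCompletion v p hv).𝔅 τ.toRingHom = {a, b})) → ¬ (∀ v : IsDedekindDomain.HeightOneSpectrum (NumberField.RingOfIntegers F), ((p : ℕ) : NumberField.RingOfIntegers F) ∈ v.asIdeal → Literature.NumberTheory.GaloisRepresentations.FramedRep.HasInvariantCompleteFlag (ρ.toLocal v)) → ¬ (11 ≤ p ∧ (∃ v w : IsDedekindDomain.HeightOneSpectrum (NumberField.RingOfIntegers F), v ≠ w ∧ ((p : ℕ) : NumberField.RingOfIntegers F) ∈ v.asIdeal ∧ ((p : ℕ) : NumberField.RingOfIntegers F) ∈ w.asIdeal) ∧ (∀ (v : IsDedekindDomain.HeightOneSpectrum (NumberField.RingOfIntegers F)) (hv : ((p : ℕ) : NumberField.RingOfIntegers F) ∈ v.asIdeal), (Literature.NumberTheory.PAdicHodge.fontainePstAdicCompletion v p hv).IsCrystallineFramed (ρ.toLocal v)) ∧ Literature.NumberTheory.GaloisRepresentations.FramedGaloisRep.IsResiduallyAbsIrreducible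 (ρ.restrictField (CyclotomicField p F))) → ∃ g : ℤ, ∀ (v : IsDedekindDomain.HeightOneSpectrum (NumberField.RingOfIntegers F)) (hv : ((p : ℕ) : NumberField.RingOfIntegers F) ∈ v.asIdeal), letI := (Literature.NumberTheory.PAdicHodge.fontainePstAdicCompletion v p hv).algebra; ∀ τ : v.adicCompletion F →ₐ[ℚ_[p]] PadicAlgCl p, ∃ a : ℤ, ρ.labelledHodgeTateWeightsAt v (Literature.NumberTheory.PAdicHodge.fontainePstAdicCompletion v p hv).algebra (Literature.NumberTheory.PAdicHodge.fontainePstAdicCompletion v p hv).𝔅 τ.toRingHom = {a, a + g}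

-- earlier VoidToLanglands (stmt-Langlands-17004, replaced 2026-08-16T21:53:47Z -> stmt-Langlands-17006): retired by None — Target → Langlands
/-- item stmt-Langlands-17006 · crux · rank 9 · open · by planner
why it might fail: Rest of the mountain: not claimed by this route (crux-kind only for the crux-only deciding theorem); not to be staffed from here.
sources: BuzzardGeeLMS2014, CalegariMazur2008
[support] OUT-OF-SCOPE REMAINDER Target → Langlands, declared and NOT claimed (D-0027 §2.1 pattern):
everything in the summit beyond the vacuity of (B) on the non-parallel sector for n = 2 over
imaginary quadratic fields. Not to be staffed from this route. [difficulty: open-problem] -/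
@[route_item "route-Langlands-NonParallelVoid", crux]
def VoidToLanglands : Prop :=
  (∀ (F : Type) [Field F] [NumberField F] [Algebra.IsQuadraticExtension ℚ F], NumberField.IsTotallyComplex F → ∀ (p : ℕ) [Fact p.Prime] (ρ : Literature.NumberTheory.GaloisRepresentations.FramedGaloisRep F (PadicAlgCl p) 2), ρ.toGaloisRep.IsIrreducible → (∀ᶠ v : IsDedekindDomain.HeightOneSpectrum (NumberField.RingOfIntegers F) in Filter.cofinite, ρ.IsUnramifiedAt v) → (∀ (v : IsDedekindDomain.HeightOneSpectrum (NumberField.RingOfIntegers F)) (hv : ((p : ℕ) : NumberField.RingOfIntegers F) ∈ v.asIdeal), (Literature.NumberTheory.PAdicHodge.fontainePstAdicCompletion v p hv).IsDeRhamFramed (ρ.toLocal v) ∧ (letI := (Literature.NumberTheory.PAdicHodge.fontainePstAdicCompletion v p hv).algebra; ∀ τ : v.adicCompletion F →ₐ[ℚ_[p]] PadicAlgCl p, ∃ a b : ℤ, a < b ∧ ρ.labelledHodgeTateWeightsAt v (Literature.NumberTheory.PAdicHodge.fontainePstAdicCompletion v p hv).algebra (Literature.NumberTheory.PAdicHodge.fontainePstAdicCompletion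 v p hv).𝔅 τ.toRingHom = {a, b})) → ∃ g : ℤ, ∀ (v : IsDedekindDomain.HeightOneSpectrum (NumberField.RingOfIntegers F)) (hv : ((p : ℕ) : NumberField.RingOfIntegers F) ∈ v.asIdeal), letI := (Literature.NumberTheory.PAdicHodge.fontainePstAdicCompletion v p hv).algebra; ∀ τ : v.adicCompletion F →ₐ[ℚ_[p]] PadicAlgCl p, ∃ a : ℤ, ρ.labelledHodgeTateWeightsAt v (Literature.NumberTheory.PAdicHodge.fontainePstAdicCompletion v p hv).algebra (Literature.NumberTheory.PAdicHodge.fontainePstAdicCompletion v p hv).𝔅 τ.toRingHom = {a, a + g}) → Langlands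

/-- item stmt-Langlands-17005 · assembly · rank 1 · open · by planner
sources: CalegariMazur2008, Calegari2010
[assembly] EmptyWeightCore → TwistedInductionParallel → TensorSquareParallel →
LocallyReducibleParallel → ResidueParallel → VoidToLanglands → Langlands (the five cruxes give
Target by the exhaustive case split; VoidToLanglands carries Target to the summit constant). -/
@[route_item "route-Langlands-NonParallelVoid"]
def Assembly : Prop :=
  EmptyWeightCore → TwistedInductionParallel → TensorSquareParallel → LocallyReducibleParallel → ResidueParallel → VoidToLanglands → Langlands

/-! D-0027 §2.1 — DECIDING THEOREM (planner-authored via `route open/edit --closes-file`; by planner-rrepair-Langlands-NonParallelVoid-4d345d27-0 2026-08-16T22:02:38Z):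
its hypotheses are this route's items and its conclusion the sub-problem Statement (glue_lint), and it elaborates with this file. -/

@[closes "route-Langlands-NonParallelVoid"] theorem closes (h2 : EmptyWeightCore) (h3 : TwistedInductionParallel) (h4 : TensorSquareParallel)
    (h5 : LocallyReducibleParallel) (h6 : ResidueParallel) (hL : VoidToLanglands) : Langlands := by
  apply hL
  intro F _ _ _ hF p _ ρ hirr hunr hHT
  by_cases hLR : (∀ v : IsDedekindDomain.HeightOneSpectrum (NumberField.RingOfIntegers F), ((p : ℕ) : NumberField.RingOfIntegers F) ∈ v.asIdeal → Literature.NumberTheory.GaloisRepresentations.FramedRep.HasInvariantCompleteFlag (ρ.toLocal v))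
  · exact h5 F hF p ρ hirr hunr hHT hLR
  · by_cases hG : (11 ≤ p ∧ (∃ v w : IsDedekindDomain.HeightOneSpectrum (NumberField.RingOfIntegers F), v ≠ w ∧ ((p : ℕ) : NumberField.RingOfIntegers F) ∈ v.asIdeal ∧ ((p : ℕ) : NumberField.RingOfIntegers F) ∈ w.asIdeal) ∧ (∀ (v : IsDedekindDomain.HeightOneSpectrum (NumberField.RingOfIntegers F)) (hv : ((p : ℕ) : NumberField.RingOfIntegers F) ∈ v.asIdeal), (Literature.NumberTheory.PAdicHodge.fontainePstAdicCompletion v p hv).IsCrystallineFramed (ρ.toLocal v)) ∧ Literature.NumberTheory.GaloisRepresentations.FramedGaloisRep.IsResiduallyAbsIrreducible (ρ.restrictField (CyclotomicField p F)))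
    · by_cases hE : (∀ (v : IsDedekindDomain.HeightOneSpectrum (NumberField.RingOfIntegers F)) (hv : ((p : ℕ) : NumberField.RingOfIntegers F) ∈ v.asIdeal) (w : IsDedekindDomain.HeightOneSpectrum (NumberField.RingOfIntegers F)) (hw : ((p : ℕ) : NumberField.RingOfIntegers F) ∈ w.asIdeal), letI := (Literature.NumberTheory.PAdicHodge.fontainePstAdicCompletion v p hv).algebra; letI := (Literature.NumberTheory.PAdicHodge.fontainePstAdicCompletion w p hw).algebra; ∀ (τ : v.adicCompletion F →ₐ[ℚ_[p]] PadicAlgCl p) (σ : w.adicCompletion F →ₐ[ℚ_[p]] PadicAlgCl p) (a b a' b' : ℤ), ρ.labelledHodgeTateWeightsAt v (Literature.NumberTheory.PAdicHodge.fontainePstAdicCompletion v p hv).algebra (Literature.NumberTheory.PAdicHodge.fontainePstAdicCompletion v p hv).𝔅 τ.toRingHom = {a, b} → a < b → ρ.labelledHodgeTateWeightsAt w (Literature.NumberTheory.PAdicHodge.fontainePstAdicCompletion w p hw).algebra (Literature.NumberTheory.PAdicHodge.fontainePstAdicCompletion w p hw).𝔅 σ.toRingHom = {a', b'} → a' < b'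 → Even (b - a + (b' - a')))
      · exact h3 F hF p ρ hirr hunr hHT hG hE
      · by_cases hB : (∃ τ : Field.absoluteGaloisGroup ℚ, τ ∉ Set.range (Literature.NumberTheory.GaloisRepresentations.absGaloisRestrict ℚ F) ∧ ∃ χ : Field.absoluteGaloisGroup F →* (Literature.NumberTheory.GaloisRepresentations.padicAlgClResidueField p)ˣ, ∀ σ σ' : Field.absoluteGaloisGroup F, Literature.NumberTheory.GaloisRepresentations.absGaloisRestrict ℚ F σ' = τ * Literature.NumberTheory.GaloisRepresentations.absGaloisRestrict ℚ F σ * τ⁻¹ → (ρ.residualRep σ').val.trace = (χ σ : Literature.NumberTheory.GaloisRepresentations.padicAlgClResidueField p) * (ρ.residualRep σ).val.trace ∧ (ρ.residualRep σ').val.det = (χ σ : Literature.NumberTheory.GaloisRepresentations.padicAlgClResidueField p) ^ 2 * (ρ.residualRep σ).val.det)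
        · exact h2 F hF p ρ hirr hunr hHT hLR hG hE hB
        · exact h4 F hF p ρ hirr hunr hHT hG hE hB
    · exact h6 F hF p ρ hirr hunr hHT hLR hG

end Summit.Langlands.Langlands.Theses.NonParallelVoid
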